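import Summits.CriticalPhenomena.Ising3DConformalLimit.Cruxes.ExistsScaleCovariantLimit.BlockZoomSupport

/-!
# Sketch — first lemmas for the round-2 crux-idea cards on `ExistsScaleCovariantLimit`
(crux stmt-CriticalPhenomena-1981; planner crux-ideate, round 2, ideator 5).

Statements only (`def … : Prop`), elaborated against Mathlib + the tree + the crux support layer
`BlockZoomSupport.lean` (namespace `…Cruxes.ExistsScaleCovariantLimit.BlockZoomExactOrbit`:
`blockMoment`, `blockVar`, `rhoB`, `FB`, `UniformBounds`, `NPointEquicontinuity`,
`FieldMomentConvergence`, `ExactZoomIdentity`, `existsScaleCovariantLimit_of_fieldMomentConvergence`).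

* Card `two-hierarchies-force-the-filter`: `TwoHierarchiesForceConvergence`,
  `DyadicLimitTriadicFixedForcesConvergence` (abstract, provable now), `LogUniformContinuity`,
  `GeometricFieldMomentConvergence b`, `TriadicFixednessOfDyadicLimit`, `TwoHierarchiesReduction`.
* Card `shear-uncages-the-mirror-modulus`: `defectCount`, `shear`, `SeparatingNormalQuant`,
  `UncagingStep`, `UpperSetTranslationModulus`, `UncagedEquicontinuity`.
-/

noncomputable section

open Filter Topology
open Literature.Probability.LatticeModels
open Summit.CriticalPhenomena.Ising3DConformalLimit.Cruxes.ExistsScaleCovariantLimit.BlockZoomExactOrbit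

namespace Summit.CriticalPhenomena.Ising3DConformalLimit.Cruxes.ExistsScaleCovariantLimit.Ideator5

/-! ## Card `two-hierarchies-force-the-filter` -/

/-- **Two hierarchies force convergence** (abstract; provable now). Let `u : ℕ → X` be an EXACT
orbit of an action of the multiplicative semigroup `(ℕ, ·)` by continuous maps `B m` on a metric
space (`u (m n) = B m (u n)`: on `ℤ³` the `m`-block field of the `L`-block field IS the `mL`-block
field), slowly oscillating in the multiplicative sense. If `u` converges along the single geometric
sequence `2^k` AND along the single geometric sequence `3^k` (to a priori unrelated limits), then
`u` converges. Proof: `v m := lim_k u (m 2^k) = B m a` exists for every `m` and `v (2m) = v m`;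
writing `3^k ≈ m_k 2^{j_k}` with `m_k` in a BOUNDED window and using slow oscillation plus the
density of `k log₂ 3 mod 1`, `v m = b` for all `m` in the window, hence for all `m`; finally every
large `n` is `≈ m 2^j` with bounded `m`. The orbit structure is essential (for a bare sequence,
convergence along `2^k` and `3^k` with slow oscillation does NOT give convergence). -/
def TwoHierarchiesForceConvergence : Prop :=
  ∀ (X : Type) [MetricSpace X] (u : ℕ → X) (B : ℕ → X → X),
    (∀ m, 1 ≤ m → Continuous (B m)) →
    (∀ m n, 1 ≤ m → 1 ≤ n → u (m * n) = B m (u n)) →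
    (∀ ε > 0, ∃ η > 0, ∃ N : ℕ, ∀ n m : ℕ, N ≤ n → N ≤ m →
        |(m : ℝ) / (n : ℝ) - 1| < η → dist (u m) (u n) < ε) →
    (∃ a, Tendsto (fun k : ℕ => u (2 ^ k)) atTop (𝓝 a)) →
    (∃ b, Tendsto (fun k : ℕ => u (3 ^ k)) atTop (𝓝 b)) →
    ∃ c, Tendsto u atTop (𝓝 c)

/-- **One hierarchy plus triadic fixedness** (abstract variant; provable now). Same setting; if `u`
converges along `2^k` to `a` and the dyadic limit is fixed by ONE multiplicatively independent
blocking, `B 3 a = a`, then `u` converges (to `a`). Proof: the semigroup law `B (3m) = B m ∘ B 3`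
holds on the orbit by exactness and passes to its closure by continuity, so `v (3m) = v m`,
`v (2m) = v m`; density of `{2^p 3^q}` in `ℝ₊` and slow oscillation give `v ≡ a`. -/
def DyadicLimitTriadicFixedForcesConvergence : Prop :=
  ∀ (X : Type) [MetricSpace X] (u : ℕ → X) (B : ℕ → X → X),
    (∀ m, 1 ≤ m → Continuous (B m)) →
    (∀ m n, 1 ≤ m → 1 ≤ n → u (m * n) = B m (u n)) →
    (∀ ε > 0, ∃ η > 0, ∃ N : ℕ, ∀ n m : ℕ, N ≤ n → N ≤ m →
        |(m : ℝ) / (n : ℝ) - 1| < η → dist (u m) (u n) < ε) →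
    ∀ a, Tendsto (fun k : ℕ => u (2 ^ k)) atTop (𝓝 a) → B 3 a = a →
      Tendsto u atTop (𝓝 a)

/-- **Log-uniform continuity of the block-normalised orbit** (lattice side; provable now, M-sized,
from `BlockMomentBounds` and the automatic susceptibility doubling `blockVar (L+1) ≤ (1 + C/L)
blockVar L`): the smeared block-normalised moments move by at most `ε` when the mesh changes by a
factor within `η` of `1`, uniformly as `δ → 0⁺`. This is the "slow oscillation" hypothesis of the
two abstract lemmas; it carries NO existence content (a discretely self-similar orbit satisfies it). -/
def LogUniformContinuity : Prop :=
  ∀ (n : ℕ) (f : Fin n → SchwartzMap (EuclideanSpace ℝ (Fin 3)) ℝ), ∀ ε > 0, ∃ η > 0, ∃ δ₀ > 0,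
    ∀ δ ∈ Set.Ioo (0:ℝ) δ₀, ∀ δ' ∈ Set.Ioo (0:ℝ) δ₀, |δ' / δ - 1| < η →
      |blockMoment δ' n f - blockMoment δ n f| < ε

/-- **Single-hierarchy convergence `D_b`**: the block-normalised smeared moments converge along the
ONE geometric mesh sequence `δ = b^{-k}` (the Wilson–Kadanoff statement "the `b`-block-spin
iteration of critical `ℤ³` Ising converges", law level, forced normalisation `ρ_B`). `D 2` and `D 3`
are the two open stubs of the card; each is strictly weaker than `FieldMomentConvergence` (the
disprover's `W_ε` has a dyadic limit and no triadic one). -/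
def GeometricFieldMomentConvergence (b : ℕ) : Prop :=
  ∀ (n : ℕ) (f : Fin n → SchwartzMap (EuclideanSpace ℝ (Fin 3)) ℝ), ∃ M : ℝ,
    Tendsto (fun k : ℕ => blockMoment (((b : ℝ) ^ k)⁻¹) n f) atTop (𝓝 M)

/-- **Triadic fixedness of the dyadic limit `N₃`** (the alternative second stub): along `δ = 2^{-k}`,
the block-normalised moments at mesh `δ/3` and at mesh `δ` have the same limit — i.e. the dyadic
limit law is invariant under ONE `3`-blocking. With `D 2` this replaces `D 3`
(`DyadicLimitTriadicFixedForcesConvergence`). -/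
def TriadicFixednessOfDyadicLimit : Prop :=
  ∀ (n : ℕ) (f : Fin n → SchwartzMap (EuclideanSpace ℝ (Fin 3)) ℝ),
    Tendsto (fun k : ℕ => blockMoment ((3 * (2 : ℝ) ^ k)⁻¹) n f - blockMoment (((2 : ℝ) ^ k)⁻¹) n f)
      atTop (𝓝 0)

/-- **The reduction the card asks a crux-plan to kernel-check**: two single-hierarchy convergences
plus the provable glue (`LogUniformContinuity`, the exact `(ℕ,·)`-orbit structure
`ExactZoomIdentity`, and `TwoHierarchiesForceConvergence` instantiated on the countable product of
moment coordinates over a dilation-stable countable dense family of Schwartz functions together with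
the scalar cocycle `blockVar (m L) / blockVar L`) give `FieldMomentConvergence`, the interface of
`BlockZoomSupport.existsScaleCovariantLimit_of_fieldMomentConvergence`. -/
def TwoHierarchiesReduction : Prop :=
  GeometricFieldMomentConvergence 2 → GeometricFieldMomentConvergence 3 →
    LogUniformContinuity → ExactZoomIdentity → FieldMomentConvergence

/-- Variant of the reduction with `N₃` in place of `D 3`. -/
def OneHierarchyReduction : Prop :=
  GeometricFieldMomentConvergence 2 → TriadicFixednessOfDyadicLimit →
    LogUniformContinuity → ExactZoomIdentity → FieldMomentConvergence

/-! ## Card `shear-uncages-the-mirror-modulus` -/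

/-- Number of `η`-DEFECTS of a configuration: ordered triples (mirror normal `u`, `i ≠ j`) whose
`u`-projections differ by less than `η` (a CAGED configuration has defects at every small `η`; a
totally uncaged one has none). Counted with `Set.ncard` over a finite index set. -/
def defectCount (n : ℕ) (x : Fin n → EuclideanSpace ℝ (Fin 3)) (η : ℝ) : ℕ :=
  Set.ncard {p : Site 3 × Fin n × Fin n | IsMirrorNormal p.1 ∧ p.2.1 ≠ p.2.2 ∧
    |inner ℝ (toE p.1) (x p.2.1 - x p.2.2)| < η}

/-- The upper-set SHEAR: translate every point whose `u`-projection is `≥ t` rigidly by `a • u`. -/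
def shear (n : ℕ) (x : Fin n → EuclideanSpace ℝ (Fin 3)) (u : Site 3) (t a : ℝ) :
    Fin n → EuclideanSpace ℝ (Fin 3) :=
  fun j => if t ≤ inner ℝ (toE u) (x j) then x j + a • toE u else x j

/-- **Separating normal (finite geometry of the B₃ arrangement; provable now)**: for each of the
nine lattice mirror normals `u`, the normals NOT orthogonal to `u` (together with `u`) span `ℝ³`,
quantitatively: some mirror normal `u'` with `⟪u, u'⟫ ≠ 0` sees at least a fixed fraction of any
vector `d`. Consequence: if `xᵢ − xⱼ` is (nearly) invisible to `u` it is visible to such a `u'`, and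
shearing an upper set of `u'` that separates `i` from `j` changes `⟪u, xᵢ − xⱼ⟫` by `a⟪u,u'⟫ ≠ 0` —
the cage opens. -/
def SeparatingNormalQuant : Prop :=
  ∃ c : ℝ, 0 < c ∧ ∀ (u : Site 3) (d : EuclideanSpace ℝ (Fin 3)), IsMirrorNormal u →
    ∃ u' : Site 3, IsMirrorNormal u' ∧ inner ℝ (toE u) (toE u') ≠ 0 ∧ c * ‖d‖ ≤ |inner ℝ (toE u') d|

/-- **Uncaging step (finite geometry + pigeonhole; provable now)**. For `n` points with mutual
distances `≥ ρ` in a ball of radius `R` there is a margin `g > 0` (depending on `n, ρ, R` only)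
such that, for every `θ ≤ θ₀(n)` and every scale `0 < s < g/2`: either the configuration has no
`θs`-defect, or ONE shear of size `|a| ∈ [s/2, s]` along a mirror normal, applied to an upper set
whose threshold sits in a projection GAP of width `≥ g` (so the polarised-RP estimate applies with a
margin independent of the cage), strictly decreases the number of `θs`-defects and creates none.
(Pick a defect `(u,i,j)`; `SeparatingNormalQuant` gives `u'`; pigeonhole among `≤ n` projection
values between `⟪u',xⱼ⟫` and `⟪u',xᵢ⟫` gives the gap; the bad shear sizes form `≤ 9n²` intervals of
length `≤ 2θs`.) Iterating `≤ 9n²` times uncages every configuration by shears of total size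
`≤ 9n² s` — checked numerically: the unit cube (rank of cage-preserving moves 15 < 24) is uncaged in
14 generic shears with size/margin ≤ 0.044; 2×2×3 grid in 20; bcc cell in 16. -/
def UncagingStep : Prop :=
  ∀ (n : ℕ) (ρ R : ℝ), 0 < ρ → 0 < R → ∃ g θ₀ : ℝ, 0 < g ∧ 0 < θ₀ ∧
    ∀ θ ∈ Set.Ioc (0:ℝ) θ₀, ∀ (x : Fin n → EuclideanSpace ℝ (Fin 3)),
      (∀ i j, i ≠ j → ρ ≤ dist (x i) (x j)) → (∀ i, ‖x i‖ ≤ R) →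
      ∀ s ∈ Set.Ioo (0:ℝ) (g / 2), defectCount n x (θ * s) = 0 ∨
        ∃ (u : Site 3) (t a : ℝ), IsMirrorNormal u ∧ s / 2 ≤ |a| ∧ |a| ≤ s ∧
          (∀ j, inner ℝ (toE u) (x j) ∉ Set.Ioo (t - g) t) ∧
          defectCount n (shear n x u t a) (θ * s) < defectCount n x (θ * s)

/-- **Upper-set translation modulus (polarised reflection positivity in the nine mirrors; L-sized,
provable track — the actual mechanism behind BlockZoomSupport's `IsolatedModulus`)**: translating
an UPPER SET `{j : ⟪u, xⱼ⟫ ≥ t}` rigidly by a lattice-exact amount `kδ·u` along a mirror normal `u`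
changes the block-normalised correlator by at most `C(g)·(|k|δ + δ)^{1/2}` whenever the threshold
`t` sits in a projection gap of width `g` (no point projects into `(t − g, t)`), uniformly for
`δ < δ₀(g)` on compacts of `NonCoincident`. Mechanism: with the two-plane transfer contraction
`0 ≤ T_u ≤ 1` of the critical state in direction `u` (site+bond planes for `eᵢ`, consecutive site
planes `xᵢ ± xⱼ = k, k+1` for the diagonals; `CriticalCorrNineMirrorRP`), the correlator is
`⟪v, T_u^k w⟫` for the two clusters, `|⟪v,T^k w⟫ − ⟪v,T^{k+1}w⟫| ≤ √((c_k(v) − c_{k+1}(v))(c_k(w) −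
c_{k+1}(w))) ≤ √(c_j(v)c_j(w))/(k − j + 1)`, and the diagonal quantities `c_j` are bounded by
`UniformBounds` at separation `g/2` — NO doubling, NO isolation of single points. -/
def UpperSetTranslationModulus : Prop :=
  ∀ (n : ℕ) (K : Set (Fin n → EuclideanSpace ℝ (Fin 3))), K ⊆ NonCoincident 3 n → IsCompact K →
    ∀ g : ℝ, 0 < g → ∃ C δ₀ h₀ : ℝ, 0 < δ₀ ∧ 0 < h₀ ∧ ∀ δ ∈ Set.Ioo 0 δ₀, ∀ x ∈ K,
      ∀ (u : Site 3) (t : ℝ) (k : ℤ), IsMirrorNormal u → |(k : ℝ)| * δ ≤ h₀ →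
        (∀ j, inner ℝ (toE u) (x j) ∉ Set.Ioo (t - g) t) →
        |FB n δ (shear n x u t ((k : ℝ) * δ)) - FB n δ x| ≤ C * (|(k : ℝ)| * δ + δ) ^ (1 / 2 : ℝ)

/-- **Uncaged equicontinuity (the glue; M-sized, provable given its inputs)**: shear every
configuration of a compact `K` to a `θs`-uncaged one by `≤ 9n²` gap-`g` shears of size `≤ s`
(`UncagingStep`, cost `≤ 9n² C(g)(s + δ)^{1/2}` each side), then move points one at a time between
the two uncaged configurations by differences of upper-set translations with margin `θs` (cost
`C(θs)·(dist + δ)^{1/2}`): choosing `s = s(ε)` first and the modulus `r = r(ε, s)` second gives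
clause (b) of `NPointEquicontinuity` at EVERY configuration — caged ones included; clause (a) is
`UniformBounds`. -/
def UncagedEquicontinuity : Prop :=
  UpperSetTranslationModulus → UncagingStep → UniformBounds → NPointEquicontinuity

end Summit.CriticalPhenomena.Ising3DConformalLimit.Cruxes.ExistsScaleCovariantLimit.Ideator5

end
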